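import Literature.Analysis.TotalPositivity.GenusZeroSector
import HarnessLib

/-!
# Splitting off the finitely many zeros outside a sector — real entire functions of genus zero

Trunk T-ANALYSIS (Literature/Analysis/TotalPositivity). The zero-splitting step of the tree's
proof of Katkova's Theorem 3 [Katkova2006, Thm. 3: `e^{nz} ξ₁(z), cosh(n√z) ξ₁(z) ∈ PF_m` for
`n ≥ n₀(m)`], see `Literature/NumberTheory/LFunctions/XiMultiplePositivityExpFactorsProofs.lean`.
Katkova's Theorem 1 argument (`GenusZeroSector.lean`: a real entire `F` of order `< 1` with
`F(0) > 0` and ALL zeros in `|arg z| ≥ πm/(m+1)` has an `m`-times positive Taylor sequence) is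
refined to the situation of Theorem 3, where finitely many zeros may lie outside the sector:

**Theorem** (`exists_sector_factorisation`). Let `F` be entire with `‖F z‖ ≤ C exp(‖z‖^ρ)`,
`ρ < 1`, real Taylor coefficients at `0`, `F(0) > 0`, and suppose the zeros of `F` in the open
sector `|arg z| < πm/(m+1)` are bounded in modulus. Then `F = F(0) · Q · G` with `Q` a REAL
polynomial, `Q(0) = 1`, and `G` entire with real Taylor coefficients whose Taylor sequence
`(G⁽ⁿ⁾(0)/n!)ₙ` is `m`-times positive.

Proof (given Hadamard's factorisation in genus `0`, `hH`, and Schoenberg's Theorem B, `hB`, both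
theorems of the tree): write `F/F(0) = ∏ₙ (1 - bₙ z)`, `Σ |bₙ| < ∞`. The indices `n` with
`bₙ ≠ 0`, `|arg bₙ⁻¹| < πm/(m+1)` form a FINITE set `Bad` (the corresponding zeros `bₙ⁻¹` are
bounded, so `|bₙ|` is bounded below, and `Σ |bₙ| < ∞`); it is a union of fibres of `b`, closed
under conjugation with multiplicities (`ncard_fiber_conj`), so `Q := ∏_{n ∈ Bad} (1 - bₙ z)` is a
real polynomial (`prod_one_sub_conj_mul`, `exists_map_ofReal_eq`). The remaining product
`G := ∏_{n ∉ Bad} (1 - bₙ z)` is the locally uniform limit of the real polynomials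
`∏_{n ∈ symmTrunc M ∖ Bad} (1 - bₙ z)`, which are positive at `0` and zero-free in the open
sector, hence `PF_m` by Theorem B; Taylor coefficients pass to the limit (they stay real) and
`PF_m` is closed under termwise limits — verbatim Katkova's limiting argument
[Katkova2006, proof of Thm. 1, arXiv p. 4].

## References

* O. M. Katkova, *Multiple positivity and the Riemann zeta-function*, CMFT 7 (2007) 13–31;
  arXiv:math/0505174, Thm. 1 (proof) and Thm. 3. [Katkova2006]
* J. B. Conway, *Functions of One Complex Variable I*, 2nd ed. 1978, Ch. XI Thm. 3.4 (Hadamard).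
  [Conway1978]
-/

noncomputable section

open Filter Complex Polynomial Set Metric
open scoped Topology Nat ComplexConjugate

namespace Literature.Analysis.TotalPositivity

/-- `|arg (conj x)| = |arg x|`. [folklore] -/
theorem abs_arg_conj (x : ℂ) : |arg (conj x)| = |arg x| := by
  rw [Complex.arg_conj]
  split_ifs with h
  · rw [h]
  · rw [abs_neg]

/-- **Splitting off the zeros outside the sector.** See the module docstring. GIVEN Hadamard's
factorisation in genus `0` (`hH`, [Conway 1978, XI.3.4]) and Schoenberg's sector theorem (`hB`,
[Katkova2006, §1 Thm. B]): a real entire `F` of order `< 1` with `F(0) > 0` whose zeros in the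
open sector `|arg z| < πm/(m+1)` are bounded factors as `F = F(0) · Q · G`, `Q` a real polynomial
with `Q(0) = 1`, `G` entire with real, `m`-times positive Taylor sequence at `0`.
[cite: Katkova2006, Thm. 1 (proof, arXiv p. 4) and Thm. 3] -/
theorem exists_sector_factorisation (hH : Literature.Analysis.Complex.hadamard_genus_zero)
    (hB : schoenberg_sector_pf) {m : ℕ} {F : ℂ → ℂ} (hF : IsEntireOfOrderLtOne F)
    (hreal : ∀ n : ℕ, (iteratedDeriv n F 0).im = 0) (h0 : 0 < (F 0).re)
    (hbdd : ∃ W : ℝ, ∀ z : ℂ, F z = 0 → |z.arg| < Real.pi * m / (m + 1) → ‖z‖ ≤ W) :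
    ∃ (Q : ℝ[X]) (G : ℂ → ℂ), Q.eval 0 = 1 ∧ Differentiable ℂ G ∧
      (∀ n : ℕ, (iteratedDeriv n G 0).im = 0) ∧
      IsMultiplyPositiveSeq m (fun n => (iteratedDeriv n G 0).re / (n ! : ℝ)) ∧
      ∀ z : ℂ, F z = F 0 * (Q.map Complex.ofRealHom).eval z * G z := by
  classical
  obtain ⟨hdiff, ρ, C, hρ, hbound⟩ := hF
  have hF0 : F 0 ≠ 0 := fun h => by rw [h] at h0; simp at h0
  obtain ⟨b, hb, hprod⟩ := hH F ρ C hdiff hρ hbound hF0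
  -- `F 0` and `F` are real
  have hF0re : F 0 = ((F 0).re : ℂ) := by
    apply Complex.ext
    · simp
    · simpa using hreal 0
  have hF0conj : conj (F 0) = F 0 := by rw [hF0re, Complex.conj_ofReal]
  have hFconj : ∀ z, F (conj z) = conj (F z) := map_conj_of_im_iteratedDeriv_eq_zero hdiff hreal
  have hg : ∀ z, (fun w => F w / F 0) (conj z) = conj ((fun w => F w / F 0) z) := by
    intro z
    simp only [map_div₀, hF0conj, hFconj z]
  -- zeros of `F` from the data `b`
  have hzero : ∀ n, b n ≠ 0 → F (b n)⁻¹ = 0 := by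
    intro n hn
    have h1 : HasProd (fun k => 1 - b k * (b n)⁻¹) 0 :=
      hasProd_zero_of_exists_eq_zero ⟨n, by rw [mul_inv_cancel₀ hn, sub_self]⟩
    have := (hprod _).unique h1
    rcases div_eq_zero_iff.1 this with h | h
    · exact h
    · exact absurd h hF0
  -- the bad indices: a finite set
  set θ : ℝ := Real.pi * m / (m + 1) with hθ
  set P : ℂ → Prop := fun β => β ≠ 0 ∧ |(β⁻¹).arg| < θ with hP
  obtain ⟨W, hW⟩ := hbdd
  have hfin : Set.Finite {n | P (b n)} := by
    have hW0 : 0 < max W 1 := lt_of_lt_of_le one_pos (le_max_right _ _)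
    refine (finite_levelSet_of_summable_norm hb (ε := (max W 1)⁻¹) (by positivity)).subset ?_
    rintro n ⟨hn0, hnarg⟩
    have hle : ‖(b n)⁻¹‖ ≤ max W 1 := (hW _ (hzero n hn0) hnarg).trans (le_max_left _ _)
    show (max W 1)⁻¹ ≤ ‖b n‖
    rw [norm_inv] at hle
    rw [inv_le_comm₀ hW0 (norm_pos_iff.2 hn0)]
    exact hle
  set Bad : Finset ℕ := hfin.toFinset with hBad
  have hmemBad : ∀ n, n ∈ Bad ↔ P (b n) := fun n => by simp [hBad]
  -- `P` is conjugation invariant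
  have hPconj : ∀ β, P (conj β) ↔ P β := by
    intro β
    have h1 : conj β ≠ 0 ↔ β ≠ 0 := by
      rw [not_iff_not]
      constructor
      · intro h
        simpa using congrArg conj h
      · intro h
        simp [h]
    have h2 : |((conj β)⁻¹).arg| = |(β⁻¹).arg| := by
      rw [← map_inv₀, abs_arg_conj]
    simp only [hP, h1, h2]
  -- fibre counts inside `Bad`
  have hfilterBad : ∀ β : ℂ, (hβ : β ≠ 0) → (Bad.filter fun n => b n = β) =
      if P β then (finite_fiber_of_summable_norm hb hβ).toFinset else ∅ := by
    intro β hβ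
    ext n
    simp only [Finset.mem_filter, hmemBad]
    split_ifs with h
    · simp only [Set.Finite.mem_toFinset, Set.mem_setOf_eq]
      constructor
      · exact fun h' => h'.2
      · intro h'
        refine ⟨?_, h'⟩
        rw [h']
        exact h
    · simp only [Finset.notMem_empty, iff_false, not_and]
      intro h1 h2
      rw [h2] at h1
      exact h h1
  have hcardBad : ∀ β : ℂ, β ≠ 0 →
      (Bad.filter fun n => b n = β).card = (Bad.filter fun n => b n = conj β).card := by
    intro β hβ
    have hβ' : conj β ≠ 0 := by simpa using hβ
    rw [hfilterBad β hβ, hfilterBad (conj β) hβ']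
    by_cases h : P β
    · rw [if_pos h, if_pos ((hPconj β).2 h),
        ← Set.ncard_eq_toFinset_card _ (finite_fiber_of_summable_norm hb hβ),
        ← Set.ncard_eq_toFinset_card _ (finite_fiber_of_summable_norm hb hβ')]
      exact ncard_fiber_conj hb hprod hg hβ
    · rw [if_neg h, if_neg (fun h' => h ((hPconj β).1 h'))]
  -- the polynomial `Q`
  set Qc : ℂ[X] := truncPoly 1 b Bad with hQc
  have hQc_real : Qc.map (starRingEnd ℂ) = Qc :=
    map_conj_truncPoly (by simp) (fun z => prod_one_sub_conj_mul hcardBad z)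
  obtain ⟨Q, hQ, hQcoeff⟩ := exists_map_ofReal_eq hQc_real
  -- the good data and `G`
  set b' : ℕ → ℂ := fun n => if n ∈ Bad then 0 else b n with hb'def
  have hb' : Summable fun n => ‖b' n‖ := by
    refine hb.of_nonneg_of_le (fun n => norm_nonneg _) fun n => ?_
    simp only [hb'def]
    split_ifs <;> simp
  have hc : Summable fun n => ‖-b' n‖ := by simpa using hb'
  set G : ℂ → ℂ := fun z => ∏' n, (1 + -b' n * z) with hGdef
  have hGdiff : Differentiable ℂ G := differentiable_tprod_one_add hc
  -- the factorisation `F = F 0 · Qc · G`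
  have hfact : ∀ z, F z = F 0 * Qc.eval z * G z := by
    intro z
    have h1 : HasProd (fun n => if n ∈ Bad then (1 - b n * z) else 1)
        (∏ n ∈ Bad, (1 - b n * z)) := by
      have := hasProd_prod_of_ne_finset_one (L := SummationFilter.unconditional ℕ)
        (f := fun n => if n ∈ Bad then (1 - b n * z) else 1) (s := Bad)
        (fun n hn => by rw [if_neg hn])
      rw [Finset.prod_congr rfl (fun n hn => if_pos hn)] at this
      exact this
    have h2 : HasProd (fun n => 1 + -b' n * z) (G z) := hasProd_one_add hc z
    have h12 := h1.mul h2
    have hpt : (fun n => (if n ∈ Bad then (1 - b n * z) else 1) * (1 + -b' n * z)) =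
        fun n => 1 - b n * z := by
      funext n
      simp only [hb'def]
      split_ifs with hn <;> ring
    rw [hpt] at h12
    have h3 := (hprod z).unique h12
    rw [eval_truncPoly, one_mul, (div_eq_iff hF0).1 h3]
    ring
  -- the symmetric partial products of `G`
  set u : ℕ → Finset ℕ := symmTrunc hb with hu
  set PM : ℕ → ℂ[X] := fun M => truncPoly 1 b' (u M) with hPM
  have hPMeval : ∀ M z, (PM M).eval z = ∏ n ∈ u M, (1 + -b' n * z) := fun M z => by
    rw [hPM, eval_truncPoly, one_mul]
    exact Finset.prod_congr rfl fun n _ => by ring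
  -- they are real polynomials
  have hfilter' : ∀ (s : Finset ℕ) (β : ℂ), β ≠ 0 →
      (s.filter fun n => b' n = β) = if P β then ∅ else s.filter fun n => b n = β := by
    intro s β hβ
    ext n
    simp only [Finset.mem_filter, hb'def]
    by_cases hPβ : P β
    · rw [if_pos hPβ]
      simp only [Finset.notMem_empty, iff_false, not_and]
      intro _ hbn
      by_cases hn : n ∈ Bad
      · rw [if_pos hn] at hbn
        exact hβ hbn.symm
      · rw [if_neg hn] at hbn
        apply hn
        rw [hmemBad, hbn]
        exact hPβ
    · rw [if_neg hPβ, Finset.mem_filter]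
      by_cases hn : n ∈ Bad
      · rw [if_pos hn]
        constructor
        · rintro ⟨_, hbn⟩
          exact absurd hbn.symm hβ
        · rintro ⟨_, hbn⟩
          exfalso
          apply hPβ
          rw [← hbn]
          exact (hmemBad n).1 hn
      · rw [if_neg hn]
  have hcard' : ∀ (M : ℕ) (β : ℂ), β ≠ 0 →
      ((u M).filter fun n => b' n = β).card = ((u M).filter fun n => b' n = conj β).card := by
    intro M β hβ
    have hβ' : conj β ≠ 0 := by simpa using hβ
    rw [hfilter' _ β hβ, hfilter' _ (conj β) hβ']
    by_cases h : P β
    · rw [if_pos h, if_pos ((hPconj β).2 h)]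
    · rw [if_neg h, if_neg (fun h' => h ((hPconj β).1 h')), hu, filter_symmTrunc_eq hb M hβ,
        filter_symmTrunc_eq hb M hβ', Complex.norm_conj]
      split_ifs with h'
      · rw [← Set.ncard_eq_toFinset_card _ (finite_fiber_of_summable_norm hb hβ),
          ← Set.ncard_eq_toFinset_card _ (finite_fiber_of_summable_norm hb hβ')]
        exact ncard_fiber_conj hb hprod hg hβ
      · rfl
  have hPMreal : ∀ M, (PM M).map (starRingEnd ℂ) = PM M := fun M =>
    map_conj_truncPoly (by simp) (fun z => prod_one_sub_conj_mul (hcard' M) z)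
  -- locally uniform convergence `PM M → G` and convergence of the Taylor coefficients
  have hunif : TendstoLocallyUniformlyOn (fun M z => (PM M).eval z) G atTop (ball (0 : ℂ) 1) := by
    have h1 := tendstoLocallyUniformlyOn_finsetProd_one_add hc (tendsto_symmTrunc hb) 1
    refine h1.congr fun M z _ => ?_
    exact (hPMeval M z).symm
  have hPd : ∀ M, Differentiable ℂ (fun z => (PM M).eval z) := fun M =>
    Polynomial.differentiable _
  have hcoef : ∀ n, Tendsto (fun M => iteratedDeriv n (fun z => (PM M).eval z) 0) atTop
      (𝓝 (iteratedDeriv n G 0)) := fun n =>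
    (tendstoLocallyUniformlyOn_iteratedDeriv isOpen_ball hPd hunif n).tendsto_at (by simp)
  -- each `PM M` is a real polynomial with `PF_m` coefficients (Theorem B)
  have halg : algebraMap ℝ ℂ = Complex.ofRealHom := RingHom.ext fun _ => rfl
  have hPM_pf : ∀ M, ∃ p : ℝ[X], (∀ n, (p.coeff n : ℂ) = (PM M).coeff n) ∧
      IsMultiplyPositiveSeq m (fun n => p.coeff n) := by
    intro M
    obtain ⟨p, hp, hpcoeff⟩ := exists_map_ofReal_eq (hPMreal M)
    have hpc : ∀ n, (p.coeff n : ℂ) = (PM M).coeff n := fun n => by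
      have := congrArg (fun q : ℂ[X] => q.coeff n) hp
      simpa [Polynomial.coeff_map] using this
    refine ⟨p, hpc, hB m p ?_ fun z hzarg hzero => ?_⟩
    · -- `p(0) = 1 > 0`
      have h1 : (p.coeff 0 : ℂ) = 1 := by
        rw [hpc 0, Polynomial.coeff_zero_eq_eval_zero, hPMeval]
        simp
      have h2 : p.coeff 0 = 1 := by exact_mod_cast h1
      rw [h2]
      exact one_pos
    · -- a zero in the open sector would be a zero `1/bₙ`, `n ∉ Bad`, of `F` — impossible
      have heval : (PM M).eval z = 0 := by
        rw [← hp, Polynomial.eval_map]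
        rwa [Polynomial.aeval_def, halg] at hzero
      rw [hPMeval, Finset.prod_eq_zero_iff] at heval
      obtain ⟨n, -, hn⟩ := heval
      have hbz : b' n * z = 1 := by linear_combination -hn
      have hb'n : b' n ≠ 0 := fun h0' => by rw [h0', zero_mul] at hbz; exact zero_ne_one hbz
      have hnBad : n ∉ Bad := fun hmem => hb'n (by simp only [hb'def, if_pos hmem])
      have hbb : b' n = b n := by simp only [hb'def, if_neg hnBad]
      rw [hbb] at hbz
      have hbn : b n ≠ 0 := fun h0' => by rw [h0', zero_mul] at hbz; exact zero_ne_one hbz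
      have hz : z = (b n)⁻¹ := eq_inv_of_mul_eq_one_right hbz
      have hnP : ¬ P (b n) := fun hPn => hnBad ((hmemBad n).2 hPn)
      apply hnP
      refine ⟨hbn, ?_⟩
      rw [← hz]
      exact hzarg
  -- realness and `PF_m` of the Taylor sequence of `G`
  have hcoef_re : ∀ M n, iteratedDeriv n (fun z => (PM M).eval z) 0 =
      (((n ! : ℝ) * (Classical.choose (hPM_pf M)).coeff n : ℝ) : ℂ) := by
    intro M n
    have hp := (Classical.choose_spec (hPM_pf M)).1 n
    rw [iteratedDeriv_polynomial_eval_zero, ← hp]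
    push_cast
    ring
  have hGreal : ∀ n, (iteratedDeriv n G 0).im = 0 := by
    intro n
    have h := (Complex.continuous_im.tendsto _).comp (hcoef n)
    have h0 : (fun M => (iteratedDeriv n (fun z => (PM M).eval z) 0).im) = fun _ => 0 := by
      funext M
      rw [hcoef_re M n, Complex.ofReal_im]
    rw [Function.comp_def, h0] at h
    exact (tendsto_nhds_unique tendsto_const_nhds h).symm
  have hGpf : IsMultiplyPositiveSeq m (fun n => (iteratedDeriv n G 0).re / (n ! : ℝ)) := by
    refine IsMultiplyPositiveSeq.of_tendsto (l := atTop)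
      (a := fun M n => (iteratedDeriv n (fun z => (PM M).eval z) 0).re / (n ! : ℝ))
      (fun M => ?_) (fun n => ((Complex.continuous_re.tendsto _).comp (hcoef n)).div_const _)
    have hpf := (Classical.choose_spec (hPM_pf M)).2
    have heq : (fun n => (iteratedDeriv n (fun z => (PM M).eval z) 0).re / (n ! : ℝ)) =
        fun n => (Classical.choose (hPM_pf M)).coeff n := by
      funext n
      rw [hcoef_re M n, Complex.ofReal_re, mul_div_cancel_left₀]
      exact_mod_cast n.factorial_ne_zero
    rw [heq]
    exact hpf
  refine ⟨Q, G, ?_, hGdiff, hGreal, hGpf, fun z => ?_⟩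
  · have h1 : (Q.coeff 0 : ℂ) = 1 := by
      rw [hQcoeff 0, Polynomial.coeff_zero_eq_eval_zero, eval_truncPoly]
      simp
    rw [← Polynomial.coeff_zero_eq_eval_zero]
    exact_mod_cast h1
  · rw [hQ]
    exact hfact z

end Literature.Analysis.TotalPositivity
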